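import Literature.NumberTheory.PAdicHodge.DualExpElliptic
import Literature.NumberTheory.EllipticCurves.IsogenyFrobeniusTraceProofs
import Literature.NumberTheory.EllipticCurves.RationalTateModuleSequence
import HarnessLib

set_option autoImplicit false

/-!
# Kato, LNM 1553 (1993) Ch. II §1.2.4 / Bloch–Kato (1990) Def. 3.10: the dual exponential is NATURAL in the
# representation — in the `expStarCoord` currency of the tree, for an ISOGENY (or endomorphism) of elliptic curves:
# `exp*_{ω′}(φ_* η) = μ · exp*_ω(η)` with `(id ⊗ V_pφ) ω = μ · ω′`, and `μ² = m` when `φ ∘ φ = [m]`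

Topic `NumberTheory/EllipticCurves`, sub-directory `Kato2004` (namespace = path).  Cell `bsd-cm`, seat `bsd-cm-k-ty1` g29
(literature-prover; hands on row K2C-6 of crux `stmt-BirchSwinnertonDyer-19945`, offer (o5a), pen D1007 (B)): the «[T2]
isogeny instance» of the cell's R3C memo (m3) / §C memo (C6)(e2) — the abstract naturality `PeriodRingData.dualExp_map`
(`PAdicHodge/BlochKatoDualExponential.lean`) and the scale law `FilZeroLine.dualExpCoord_smul` (`NeronDeRhamDatum.lean`)
INSTANTIATED on the Tate modules of two elliptic curves `W, W′` over a subfield `K₀` of a `p`-adic field `F` and the map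
`V_pφ` of a `K₀`-isogeny `φ : W → W′`, for the tree's scalar dual exponential `PAdicHodge.expStarCoord W hp d η` of a
continuous crossed homomorphism `η : Γ_F → T_pW` along a generator `d.ω` of the line `D⁰_dR(V_pW|_{Γ_F})`.
HONEST FRAMING: theorems only (no `def`, no instance, no named fact); the Prop-1.2.3 binders `CupLogInjective` /
`HasDualExp` are carried as hypotheses exactly as in `DualExpElliptic.lean`; the tangent-space scalar `μ` of the isogeny on
the `Fil⁰`-lines is a HYPOTHESIS `(id ⊗ V_pφ) d.ω = μ • d′.ω` (its existence and non-vanishing are proved —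
`exists_ne_zero_tensorMap_eq_smul` —, its VALUE, e.g. `φ^*ω′ = μ ω` through the de Rham comparison, is not derivable in
the tree and is not asserted); for an endomorphism with `φ ∘ φ = [m]` the constraint `μ² = m` IS derived
(`sq_eq_of_comp_self`: `μ = ±√m`, e.g. `±√−7` for the CM endomorphism of a `𝒞₇` member).  Nothing about any zeta value,
main conjecture or BSD is asserted; no summit statement is touched.

## Statements (all proved)

* §1 `rationalTateModuleMap_restricted` (`V_pφ = RationalTateModule.map p φ` intertwines the restricted representations
  `restrictedRationalTateRep W F p`, `… W′ F p` of `Γ_F`), `rationalTateModuleMap_bijective` (`V_pφ` is bijective, `p ≠ char K₀`).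
* §2 ★ `expStarCoord_eq_mul_of_tensorMap_eq_smul`: for cocycles `η` of `T_pW` and `η′` of `T_pW′` with `η′ = T_pφ ∘ η`
  pointwise, generators `d`, `d′` with `(id ⊗ V_pφ) d.ω = μ • d′.ω`, and the Prop-1.2.3 binders:
  `expStarCoord W′ hp d′ η′ = μ * expStarCoord W hp d η`  (`exp*(V_pφ ∘ z) = (id ⊗ V_pφ)(exp* z) = c·μ·ω′`).
* §3 `exists_ne_zero_tensorMap_eq_smul`: such a `μ ≠ 0` exists for every pair of generators (`V_pφ` is an isomorphism for
  elliptic `W, W′` in characteristic `0`: `Isogeny.baseChange_tateModule_map_bijective`; generators differ by units: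
  `FilZeroLine.exists_ne_zero_and_eq_smul` after `FilZeroLine.map`); ★ `exists_ne_zero_expStarCoord_eq_mul` packages §2+§3.
* §4 endomorphisms: `tensorMap_tensorMap_eq_zsmul_of_comp_self` (`φ ∘ φ = [m] ⇒ (id ⊗ V_pφ)² = m` on `B ⊗ V_pW`) and
  ★ `sq_eq_of_comp_self` (`(id ⊗ V_pφ) d.ω = μ • d.ω ⇒ μ² = m`); ★ `expStarCoord_endo_eq_mul`: `exp*_ω(φ_* η) = μ · exp*_ω(η)`
  with `μ² = m` — the shape of the cell's `DualExpValueDatum.val_piK` («the CM operator acts on values by `√−7`») once `val`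
  is a composite of `expStarCoord` with restriction to a place above `p` (restriction commutes with `T_pφ`-push-forward).

## References
* K. Kato, LNM 1553 (1993), Ch. II §1.2.4 (naturality of `exp*`), Ex. 1.3.5 (`V_pA` de Rham; `D⁰_dR` = cotangent line). [Kato1993LNM1553]
* S. Bloch, K. Kato (1990), Def. 3.10 and Ex. 3.11 (the exponential of an abelian variety; functoriality). [BlochKato1990]
* K. Kato, Astérisque 295 (2004), 15.14 (p. 264: `O_λ` acts on the cohomology and on `D_dR` through the CM lattice),
  (15.16.1) (p. 265). [Kato2004Asterisque]
* J. H. Silverman, *AEC* (2009), III.7.4 (`T_ℓφ`, `V_ℓφ`), Thm. III.6.2. [SilvermanAEC2009]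
* Tree: `PAdicHodge/BlochKatoDualExponential.lean` (`tensorMap`, `dualExp_map`, `dualExpCoord_eq`),
  `PAdicHodge/NeronDeRhamDatum.lean` (`FilZeroLine`, `.map`, `.smul`, `dualExp_eq_coord_smul`, `exists_ne_zero_and_eq_smul`),
  `PAdicHodge/DualExpElliptic.lean` (`restrictedTateRep`, `restrictedRationalTateRep`, `expStarCoord`),
  `IsogenyFrobeniusTraceProofs.lean` (`Isogeny.baseChange_tateModule_map_bijective`, `…_rationalGaloisRepTate`),
  `RationalTateModuleSequence.lean` (`RationalTateModule.map`, `map_tmul`, `map_toRational`),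
  `AlgebraicGeometry/Motives/FaltingsEC.lean` (`tateModule_map_smul`).
-/

noncomputable section

open scoped TensorProduct
open Field ValuativeRel
open Literature.NumberTheory.GaloisRepresentations
open Literature.NumberTheory.GaloisRepresentations.IsNonarchimedeanLocalField
open Literature.NumberTheory.EllipticCurves WeierstrassCurve
open Literature.NumberTheory.PAdicHodge

namespace Literature.NumberTheory.EllipticCurves.Kato2004

/-! ## §1 `V_pφ` on `T_pW ⊂ V_pW` and on the restricted representations -/

section Rational

variable {K₀ : Type} [Field K₀] {W W' : WeierstrassCurve K₀} (p : ℕ) [Fact p.Prime]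

variable (F : Type) [Field F] [Algebra K₀ F]

/-- **`V_pφ` intertwines the restricted rational Tate representations of `Γ_F`** (`φ` is defined over `K₀ ⊆ F`; base change of
`tateModule_map_smul` at `σ|_{K̄₀}`). [cite: SilvermanAEC2009, III.7.4 and III §7] -/
theorem rationalTateModuleMap_restricted [W.IsElliptic] [W'.IsElliptic] (φ : Isogeny W W') (σ : absoluteGaloisGroup F)
    (x : W.rationalTateModule p) :
    RationalTateModule.map p φ.toAddMonoidHom (restrictedRationalTateRep W F p σ x) =
      restrictedRationalTateRep W' F p σ (RationalTateModule.map p φ.toAddMonoidHom x) :=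
  φ.baseChange_tateModule_map_rationalGaloisRepTate p (absGaloisRestrict K₀ F σ) x

/-- **`V_pφ` is bijective** for an isogeny of elliptic curves when `p ≠ char K₀` (the tree's
`Isogeny.baseChange_tateModule_map_bijective`, read on the type synonym through `RationalTateModule.map`).
[cite: SilvermanAEC2009, III.7.4] -/
theorem rationalTateModuleMap_bijective [W.IsElliptic] [W'.IsElliptic] (hp0 : (p : K₀) ≠ 0) (φ : Isogeny W W') :
    Function.Bijective (RationalTateModule.map p φ.toAddMonoidHom :
      W.rationalTateModule p →ₗ[ℚ_[p]] W'.rationalTateModule p) :=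
  φ.baseChange_tateModule_map_bijective p hp0

end Rational

/-! ## §2 The naturality of `exp*_ω` along an isogeny, with the tangent-space scalar explicit -/

section ExpStar

variable {K₀ : Type} [Field K₀] {W W' : WeierstrassCurve K₀} [W.IsElliptic] [W'.IsElliptic]
  {F : Type} [Field F] [Algebra K₀ F] [ValuativeRel F] [TopologicalSpace F]
  [IsNonarchimedeanLocalField F] [CharZero F] {p : ℕ} [Fact p.Prime]
  [Fact (¬ IsUnit (p : integerC F))] [IsAdicComplete (Ideal.span {(p : integerC F)}) (integerC F)]
  (hp : valuation F p < 1) [Algebra ℚ_[p] F]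

/-- **NATURALITY OF THE SCALAR DUAL EXPONENTIAL ALONG AN ISOGENY.**  Let `φ : W → W′` be an isogeny over `K₀ ⊆ F`,
`η : Γ_F → T_pW`, `η′ : Γ_F → T_pW′` continuous crossed homomorphisms with `η′ = T_pφ ∘ η`, `d.ω`, `d′.ω` generators of the
lines `D⁰_dR(V_pW|_{Γ_F})`, `D⁰_dR(V_pW′|_{Γ_F})` with `(id ⊗ V_pφ) d.ω = μ • d′.ω`, and grant Kato's Prop. 1.2.3 binders
(`CupLogInjective` on both sides, `HasDualExp` for `η ⊗ ℚ`).  Then `exp*_{ω′}(η′) = μ · exp*_ω(η)`: `exp*` is natural in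
`V` (`dualExp_map`: `exp*(V_pφ ∘ z) = (id ⊗ V_pφ)(exp* z)`), `exp* z = exp*_ω(z)·ω`, and `(id ⊗ V_pφ)ω = μ ω′`.
[cite: Kato1993LNM1553, Ch. II §1.2.4 and Ex. 1.3.5] [cite: BlochKato1990, Def. 3.10 and Example 3.11 (p. 361)] -/
theorem expStarCoord_eq_mul_of_tensorMap_eq_smul (φ : Isogeny W W')
    (d : (bdRPeriodRingData (F := F) (p := p) hp).FilZeroLine (restrictedRationalTateRep W F p))
    (d' : (bdRPeriodRingData (F := F) (p := p) hp).FilZeroLine (restrictedRationalTateRep W' F p)) {μ : F}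
    (hμ : (bdRPeriodRingData hp).tensorMap
        (RationalTateModule.map p φ.toAddMonoidHom)
        d.ω = μ • d'.ω)
    (hinj : (bdRPeriodRingData hp).CupLogInjective (logCyclotomic p) (restrictedRationalTateRep W F p))
    (hinj' : (bdRPeriodRingData hp).CupLogInjective (logCyclotomic p) (restrictedRationalTateRep W' F p))
    (η : contOneCocycles (restrictedTateRep W F p).toTopRep) (η' : contOneCocycles (restrictedTateRep W' F p).toTopRep)
    (hη : ∀ σ, η'.1 σ = TateModule.map p φ.toAddMonoidHom (η.1 σ))
    (hz : (bdRPeriodRingData hp).HasDualExp (logCyclotomic p) (restrictedRationalTateRep W F p)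
      fun σ => TateModule.toRational p (η.1 σ)) :
    expStarCoord W' hp d' η' = μ * expStarCoord W hp d η := by
  unfold expStarCoord
  have hη' : (fun σ => TateModule.toRational p (η'.1 σ)) = fun σ =>
      (RationalTateModule.map p φ.toAddMonoidHom)
        (TateModule.toRational p (η.1 σ)) := by
    funext σ
    rw [hη σ, RationalTateModule.map_toRational]
  rw [hη']
  refine PeriodRingData.dualExpCoord_eq d'.ne_zero ?_
  rw [PeriodRingData.dualExp_map hinj hinj' (rationalTateModuleMap_restricted p F φ) hz, d.dualExp_eq_coord_smul,
    map_smul, hμ, smul_smul, mul_comm]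

/-! ## §3 The scalar exists and is a unit (for elliptic curves in characteristic `0`) -/

/-- **The tangent-space scalar of an isogeny on the `Fil⁰`-lines exists and is nonzero**: `V_pφ` is an isomorphism
(`Isogeny.baseChange_tateModule_map_bijective`; `char K₀ = 0`), so `(id ⊗ V_pφ) d.ω` generates `D⁰_dR(V_pW′)` (`FilZeroLine.map`)
and differs from `d′.ω` by a unit (`FilZeroLine.exists_ne_zero_and_eq_smul`). [cite: Kato1993LNM1553, Ch. II §1.2.4 and Ex. 1.3.5]
[cite: SilvermanAEC2009, III.7.4] -/
theorem exists_ne_zero_tensorMap_eq_smul [CharZero K₀] (φ : Isogeny W W')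
    (d : (bdRPeriodRingData (F := F) (p := p) hp).FilZeroLine (restrictedRationalTateRep W F p))
    (d' : (bdRPeriodRingData (F := F) (p := p) hp).FilZeroLine (restrictedRationalTateRep W' F p)) :
    ∃ μ : F, μ ≠ 0 ∧ (bdRPeriodRingData hp).tensorMap
        (RationalTateModule.map p φ.toAddMonoidHom)
        d.ω = μ • d'.ω := by
  have hp0 : ((p : ℕ) : K₀) ≠ 0 := by exact_mod_cast (Fact.out : p.Prime).ne_zero
  let e : W.rationalTateModule p ≃ₗ[ℚ_[p]] W'.rationalTateModule p :=
    LinearEquiv.ofBijective _ (rationalTateModuleMap_bijective p hp0 φ)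
  have he : ∀ σ m, e (restrictedRationalTateRep W F p σ m) = restrictedRationalTateRep W' F p σ (e m) :=
    fun σ m => rationalTateModuleMap_restricted p F φ σ m
  obtain ⟨c, hc, hcω⟩ := (d.map e he).exists_ne_zero_and_eq_smul d'
  refine ⟨c⁻¹, inv_ne_zero hc, ?_⟩
  have hmap : (d.map e he).ω = (bdRPeriodRingData hp).tensorMap
      (RationalTateModule.map p φ.toAddMonoidHom)
      d.ω := rfl
  rw [← hmap, hcω, smul_smul, inv_mul_cancel₀ hc, one_smul]

/-- **Naturality packaged**: for an isogeny `φ : W → W′` over `K₀ ⊆ F` (`char K₀ = 0`) and any generators `d`, `d′` there is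
ONE scalar `μ ≠ 0` such that `exp*_{ω′}(η′) = μ · exp*_ω(η)` for EVERY pair of cocycles with `η′ = T_pφ ∘ η` (under the
Prop-1.2.3 binders). [cite: Kato1993LNM1553, Ch. II §1.2.4] [cite: BlochKato1990, Def. 3.10 and Example 3.11 (p. 361)] -/
theorem exists_ne_zero_expStarCoord_eq_mul [CharZero K₀] (φ : Isogeny W W')
    (d : (bdRPeriodRingData (F := F) (p := p) hp).FilZeroLine (restrictedRationalTateRep W F p))
    (d' : (bdRPeriodRingData (F := F) (p := p) hp).FilZeroLine (restrictedRationalTateRep W' F p))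
    (hinj : (bdRPeriodRingData hp).CupLogInjective (logCyclotomic p) (restrictedRationalTateRep W F p))
    (hinj' : (bdRPeriodRingData hp).CupLogInjective (logCyclotomic p) (restrictedRationalTateRep W' F p)) :
    ∃ μ : F, μ ≠ 0 ∧
      ∀ (η : contOneCocycles (restrictedTateRep W F p).toTopRep) (η' : contOneCocycles (restrictedTateRep W' F p).toTopRep),
        (∀ σ, η'.1 σ = TateModule.map p φ.toAddMonoidHom (η.1 σ)) →
        (bdRPeriodRingData hp).HasDualExp (logCyclotomic p) (restrictedRationalTateRep W F p)
          (fun σ => TateModule.toRational p (η.1 σ)) →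
        expStarCoord W' hp d' η' = μ * expStarCoord W hp d η := by
  obtain ⟨μ, hμ0, hμ⟩ := exists_ne_zero_tensorMap_eq_smul hp φ d d'
  exact ⟨μ, hμ0, fun η η' hη hz => expStarCoord_eq_mul_of_tensorMap_eq_smul hp φ d d' hμ hinj hinj' η η' hη hz⟩

/-! ## §4 Endomorphisms: `φ ∘ φ = [m]` forces `μ² = m` (the CM operator acts on `exp*`-values by `±√m`) -/

omit [W.IsElliptic] [Algebra K₀ F] in
/-- `φ ∘ φ = [m]` on `W(K̄₀)` implies `(id ⊗ V_pφ) ((id ⊗ V_pφ) x) = m • x` on `B ⊗ V_pW` (`T_p` and `id ⊗ −` are functors,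
`T_p[m] = m`). [cite: SilvermanAEC2009, III.7.4] [cite: Kato2004Asterisque, 15.14 (p. 264)] -/
theorem tensorMap_tensorMap_eq_zsmul_of_comp_self (φ : Isogeny W W) {m : ℤ} (hφ : ∀ P, φ (φ P) = m • P)
    (x : (bdRPeriodRingData (F := F) (p := p) hp).B ⊗[ℚ_[p]] W.rationalTateModule p) :
    (bdRPeriodRingData hp).tensorMap
        (RationalTateModule.map p φ.toAddMonoidHom)
      ((bdRPeriodRingData hp).tensorMap
        (RationalTateModule.map p φ.toAddMonoidHom)
        x) = m • x := by
  -- `T_pφ ∘ T_pφ = m` on `T_pW`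
  have hT : (TateModule.map p φ.toAddMonoidHom).comp (TateModule.map p φ.toAddMonoidHom) =
      ((m : ℤ_[p])) • (LinearMap.id : W.tateModule p →ₗ[ℤ_[p]] W.tateModule p) := by
    refine LinearMap.ext fun y => ?_
    rw [LinearMap.comp_apply, LinearMap.smul_apply, LinearMap.id_apply, Int.cast_smul_eq_zsmul]
    refine TateModule.ext fun k => ?_
    rw [TateModule.proj_map, TateModule.proj_map, map_zsmul]
    exact hφ _
  -- hence `V_pφ ∘ V_pφ = m` on `V_pW` (tensor induction on the underlying type `ℚ_p ⊗ T_pW` of the synonym `V_pW`)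
  have hT' : ∀ y : W.tateModule p,
      TateModule.map p φ.toAddMonoidHom (TateModule.map p φ.toAddMonoidHom y) = m • y := fun y => by
    rw [← LinearMap.comp_apply, hT, LinearMap.smul_apply, LinearMap.id_apply, Int.cast_smul_eq_zsmul]
  have hV : ∀ v : W.rationalTateModule p,
      RationalTateModule.map p φ.toAddMonoidHom (RationalTateModule.map p φ.toAddMonoidHom v) = m • v := by
    intro v
    let G : ℚ_[p] ⊗[ℤ_[p]] W.tateModule p →+ W.rationalTateModule p :=
      ((RationalTateModule.map p φ.toAddMonoidHom).comp (RationalTateModule.map p φ.toAddMonoidHom)).toAddMonoidHom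
    let G' : ℚ_[p] ⊗[ℤ_[p]] W.tateModule p →+ W.rationalTateModule p :=
      (m • (LinearMap.id : W.rationalTateModule p →ₗ[ℤ] W.rationalTateModule p)).toAddMonoidHom
    change G v = G' v
    induction v using TensorProduct.induction_on with
    | zero => rw [map_zero, map_zero]
    | add x y hx hy => rw [map_add, map_add, hx, hy]
    | tmul c y =>
      change RationalTateModule.map p φ.toAddMonoidHom (RationalTateModule.map p φ.toAddMonoidHom
          ((c ⊗ₜ[ℤ_[p]] y : ℚ_[p] ⊗[ℤ_[p]] W.tateModule p) : W.rationalTateModule p)) =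
        m • (((c ⊗ₜ[ℤ_[p]] y : ℚ_[p] ⊗[ℤ_[p]] W.tateModule p)) : W.rationalTateModule p)
      rw [RationalTateModule.map_tmul, RationalTateModule.map_tmul, hT', ← Int.cast_smul_eq_zsmul ℤ_[p] m y,
        TensorProduct.tmul_smul]
      exact Int.cast_smul_eq_zsmul ℤ_[p] m _
  -- and on `B ⊗ V_pW`
  induction x using TensorProduct.induction_on with
  | zero => rw [map_zero, map_zero, smul_zero]
  | tmul b v => rw [PeriodRingData.tensorMap_tmul, PeriodRingData.tensorMap_tmul, hV, TensorProduct.tmul_smul]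
  | add x y hx hy => rw [map_add, map_add, hx, hy, smul_add]

/-- **`μ² = m`**: if the endomorphism `φ` with `φ ∘ φ = [m]` acts on the generator `d.ω` of `D⁰_dR(V_pW)` by `μ`
(`(id ⊗ V_pφ) d.ω = μ • d.ω`), then `μ ^ 2 = m` — so `μ = ±√m` (for the CM endomorphism `√−7` of a `𝒞₇` member: `μ² = −7`).
[cite: Kato2004Asterisque, 15.14 (p. 264, "O_λ acts … through the lattice")] [cite: Kato1993LNM1553, Ch. II §1.2.4] -/
theorem sq_eq_of_comp_self (φ : Isogeny W W) {m : ℤ} (hφ : ∀ P, φ (φ P) = m • P)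
    (d : (bdRPeriodRingData (F := F) (p := p) hp).FilZeroLine (restrictedRationalTateRep W F p)) {μ : F}
    (hμ : (bdRPeriodRingData hp).tensorMap
        (RationalTateModule.map p φ.toAddMonoidHom)
        d.ω = μ • d.ω) :
    μ ^ 2 = (m : F) := by
  have h := tensorMap_tensorMap_eq_zsmul_of_comp_self hp φ hφ d.ω
  rw [hμ, map_smul, hμ, smul_smul, ← Int.cast_smul_eq_zsmul F m d.ω] at h
  rw [pow_two]
  exact smul_left_injective F d.ne_zero h

/-- **THE CM-FUNCTORIALITY OF `exp*_ω` (shape of `DualExpValueDatum.val_piK`).**  For an endomorphism `φ` of the elliptic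
curve `W/K₀` with `φ ∘ φ = [m]`, a generator `d.ω` on which `φ` acts by `μ`, cocycles `η`, `η′ = T_pφ ∘ η`, and the Prop-1.2.3
binders: `exp*_ω(η′) = μ · exp*_ω(η)` and `μ² = m`.  (For the CM member: the `(T₇φ)_*`-push-forward multiplies dual-exponential
values by a square root of `−7` in `F`.) [cite: Kato2004Asterisque, 15.14 (p. 264) and (15.16.1) (p. 265)]
[cite: Kato1993LNM1553, Ch. II §1.2.4] [cite: BlochKato1990, Def. 3.10 and Example 3.11 (p. 361)] -/
theorem expStarCoord_endo_eq_mul (φ : Isogeny W W) {m : ℤ} (hφ : ∀ P, φ (φ P) = m • P)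
    (d : (bdRPeriodRingData (F := F) (p := p) hp).FilZeroLine (restrictedRationalTateRep W F p)) {μ : F}
    (hμ : (bdRPeriodRingData hp).tensorMap
        (RationalTateModule.map p φ.toAddMonoidHom)
        d.ω = μ • d.ω)
    (hinj : (bdRPeriodRingData hp).CupLogInjective (logCyclotomic p) (restrictedRationalTateRep W F p))
    (η η' : contOneCocycles (restrictedTateRep W F p).toTopRep)
    (hη : ∀ σ, η'.1 σ = TateModule.map p φ.toAddMonoidHom (η.1 σ))
    (hz : (bdRPeriodRingData hp).HasDualExp (logCyclotomic p) (restrictedRationalTateRep W F p)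
      fun σ => TateModule.toRational p (η.1 σ)) :
    expStarCoord W hp d η' = μ * expStarCoord W hp d η ∧ μ ^ 2 = (m : F) :=
  ⟨expStarCoord_eq_mul_of_tensorMap_eq_smul hp φ d d hμ hinj hinj η η' hη hz, sq_eq_of_comp_self hp φ hφ d hμ⟩

end ExpStar

end Literature.NumberTheory.EllipticCurves.Kato2004

end
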